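import Summits.BirchSwinnertonDyer.BirchSwinnertonDyer.Theorems.GaloisStableDivisibleSubgroupOfNoRationalCM
import Summits.BirchSwinnertonDyer.BirchSwinnertonDyer.Theorems.SchneiderFreeAdditiveX3LocalTowerTorsionFiniteOfLine
import Literature.NumberTheory.EllipticCurves.AnticyclotomicLocalNormResidueSymbolAnyPrimeProofs
import Literature.NumberTheory.EllipticCurves.FrobeniusTateModuleProofs
import Literature.NumberTheory.EllipticCurves.PrimaryGroupStableImage
import HarnessLib

/-!
# Fin_glob at ANY prime for curves without `K`-rational CM: `E(K_∞)[p^∞]` is finite on every anticyclotomic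
# `ℤ_p`-tower of an imaginary quadratic `K` in which `p` splits

Cell `bsd-print-cf2`, seat `bsd-line-cf2-p1-w2` g4 (prover, width seat on crux stmt-BirchSwinnertonDyer-20368
`PrintCf2.SplitBadTwoRankOneOfFacts`, line `eisenstein_two_bdp_line` v8.1 ff08fa12, stub **`stub_finGlob_two`**:
`Finite (FixedPoints.addSubgroup κ.kerSubgroup ((W.baseChange K).geomPrimaryTorsion 2))`). `--supports stmt-BirchSwinnertonDyer-20368`
(helper). ROUTE-FREE. THEOREMS ONLY (0 definitions, 0 named facts, 0 `sorry`). BSD is not advanced by any of this; no summit statement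
is proved by this seat.

* **`WeierstrassCurve.finite_fixedPoints_kerSubgroup_of_not_hasRationalCM`** — `E` elliptic over an imaginary quadratic `K` with NO
  `K`-rational complex multiplication, `p` ANY prime split in `K`, `κ` an anticyclotomic `ℤ_p`-extension: the `p`-primary torsion of `E`
  over `K_∞ = K̄^{ker κ}` is FINITE.
Proof. `B = E[p^∞]^{ker κ}` is `Γ_K`-stable (`ker κ ⊲ Γ_K`); if it were infinite its stable image `p^{j₀}B`
(`PrimaryGroup.exists_powRange_succ_eq`) would be a non-zero `Γ_K`-stable `p`-divisible subgroup of `E(K̄)[p^∞]`, hence ALL of `E[p^∞]` by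
`geomPrimaryTorsion_le_of_stable_divisible_of_not_hasRationalCM` (Shafarevich + `End_K(E) = ℤ`); so `Gal(K̄/K_∞)` would fix `E[p^∞]`
pointwise, i.e. act trivially on `T_pE`, and the cyclotomic character (`= det ρ_{E,p}`, `det_galoisRepTate_eq_cyclotomicCharacter_holds`)
would die on it. But the anticyclotomic norm-residue element `σ₀` of `c(π)/π` (`𝔭 ∣ p` of degree one, `𝔭^h = (π)`;
`ZpExtension.exists_isFrobPow_mem_kerSubgroup_of_isAnticyclotomic_anyPrime`, every prime) lies in `ker κ` and has `ε(σ₀)·φ(π)² = p^{2h}`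
(`mul_sq_eq_of_congruences`); `ε(σ₀) = 1` would give `φ(π)² = p^{2h}`, excluded by the weight obstruction `ne_of_unitRoot_of_span_eq_pow`
(with `α = 1`, `a = p + 1`). No parity hypothesis on `p`.
* `WeierstrassCurve.finGlob_of_not_hasRationalCM` — the same in the exact currency of the line's `stub_finGlob_two` for `E = W.baseChange K`:
  `Finite (FixedPoints.addSubgroup κ.kerSubgroup ((W.baseChange K).geomPrimaryTorsion p))`, from `¬ (W.baseChange K).HasRationalCM` and
  `SplitsIn K p`. On the crux's class (`W = 49a1^{(d)}`, CM by `ℚ(√−7)`) the hypothesis holds exactly for `K ∌ √−7`, in particular for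
  every Heegner field of `N_W` (`7² ∣ N_W`, `7` split in `K`); `2` splits there (`2 ∣ N_W`). The registered binder «every imaginary quadratic
  `K`» also covers `K = ℚ(√−7)`, where `E_K` HAS rational CM — to be excluded by the lead (the composition `_of_stubs` only consumes Heegner `K`).

References: [GreenbergLNM1716] §1 p. 62, §3 Lemma 3.3; [Serre1968] IV.2.1–2.2; [SilvermanAEC2009] III.8.3 (det = cyclotomic), Cor. IX.6.2;
[CasselsFrohlichANT1967] VII §6 Prop. 6.2; [Brink2007] §II Prop. 1.
-/

noncomputable section

open scoped Classical AddSubgroup nonZeroDivisors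

namespace WeierstrassCurve

open NumberField IsDedekindDomain Field Literature.NumberTheory.EllipticCurves
  Literature.NumberTheory.EllipticCurves.GreenbergSelmer Literature.NumberTheory.GaloisRepresentations
  Summit.BirchSwinnertonDyer.Rank1Residual.X11b
  Summit.BirchSwinnertonDyer.BirchSwinnertonDyer.Theorems.SchneiderFreeAdditiveX3
  Summit.Ventures.HodgeRepro2.T5DegreeOneNumberField

set_option linter.dupNamespace false
set_option autoImplicit false

variable {K : Type} [Field K] [NumberField K] (E : WeierstrassCurve K) [E.IsElliptic] (p : ℕ) [hp : Fact p.Prime]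

/-- **If `Gal(K̄/K_∞)` fixed `E[p^∞]` pointwise, the cyclotomic character would be trivial on it** (`det ρ_{E,p} = ε_p`, Silverman
*AEC* III.8.3, tree `det_galoisRepTate_eq_cyclotomicCharacter_holds`; the action on `T_pE = lim E[p^n]` is componentwise).
[cite: SilvermanAEC2009, Prop. III.8.3] -/
theorem cyclotomicCharacter_eq_one_of_forall_smul_eq (g : absoluteGaloisGroup K)
    (hfix : ∀ x : E.geomPrimaryTorsion p, g • x = x) :
    GaloisRep.cyclotomicCharacter K p g = 1 := by
  have hpK : (p : K) ≠ 0 := by exact_mod_cast hp.out.ne_zero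
  have hrep : E.galoisRepTate p g = LinearMap.id := by
    refine LinearMap.ext fun a ↦ TateModule.ext fun n ↦ ?_
    rw [galoisRepTate_apply_apply, TateModule.proj_smul_of_distribMulAction, LinearMap.id_apply]
    have hmem : TateModule.proj p n a ∈ E.geomPrimaryTorsion p :=
      ⟨n, AddSubgroup.torsionBy.nsmul_iff.mp (TateModule.proj_mem_torsionBy n a)⟩
    have h := congrArg Subtype.val (hfix ⟨TateModule.proj p n a, hmem⟩)
    rw [primaryComponent.coe_smul] at h
    exact h
  have hdet := det_galoisRepTate_eq_cyclotomicCharacter_holds E p hpK g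
  rw [hrep, LinearMap.det_id] at hdet
  exact Units.ext (by rw [Units.val_one]; exact hdet.symm)

/-- **Fin_glob at ANY prime for curves WITHOUT `K`-rational CM.** `E` elliptic over an imaginary quadratic `K`, `¬ E.HasRationalCM`, `p`
split in `K`, `κ` an anticyclotomic `ℤ_p`-extension of `K`: `E(K̄)[p^∞]^{ker κ} = E(K_∞)[p^∞]` is finite. See the module docstring for the
proof (stable image ⟹ `Γ_K`-stable divisible ⟹ everything by Shafarevich + `End_K = ℤ` ⟹ `ε_p` dies on `ker κ` ⟹ contradicts the norm
residue element `σ₀ ∈ ker κ` with `ε(σ₀)φ(π)² = p^{2h}`). [cite: GreenbergLNM1716, §1 p. 62 and §3 Lemma 3.3 (p. 87)]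
[cite: SilvermanAEC2009, Prop. III.8.3 and Cor. IX.6.2] [cite: CasselsFrohlichANT1967, Ch. VII §6 Prop. 6.2] -/
theorem finite_fixedPoints_kerSubgroup_of_not_hasRationalCM (hK : IsImaginaryQuadratic K) (hsplit : SplitsIn K p)
    (hCM : ¬ E.HasRationalCM) (κ : ZpExtension K p) (hκ : κ.IsAnticyclotomic) :
    Finite (FixedPoints.addSubgroup κ.kerSubgroup (E.geomPrimaryTorsion p)) := by
  have hpr : p.Prime := hp.out
  set M : AddSubgroup E.geomPoints := E.geomPrimaryTorsion p with hM
  set H : Subgroup (absoluteGaloisGroup K) := κ.kerSubgroup with hH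
  set B : AddSubgroup M := FixedPoints.addSubgroup H M with hB
  by_contra hinfB
  -- `H = ker κ` is normal: `d⁻¹ τ d ∈ H`
  have hconj : ∀ (d : absoluteGaloisGroup K), ∀ τ ∈ H, d⁻¹ * τ * d ∈ H := by
    intro d τ hτ
    rw [hH, ZpExtension.mem_kerSubgroup] at hτ ⊢
    rw [map_mul, map_mul, map_inv, hτ, mul_one, inv_mul_cancel]
  -- hence the fixed module `B` is `Γ_K`-stable
  have hBstab : ∀ (d : absoluteGaloisGroup K) {m : M}, m ∈ B → d • m ∈ B := by
    intro d m hm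
    rw [hB, FixedPoints.mem_addSubgroup] at hm ⊢
    rintro ⟨τ, hτ⟩
    have h := hm ⟨d⁻¹ * τ * d, hconj d τ hτ⟩
    rw [Subgroup.mk_smul] at h ⊢
    calc τ • d • m = d • ((d⁻¹ * τ * d) • m) := by rw [mul_smul, mul_smul, smul_inv_smul]
      _ = d • m := by rw [h]
  -- `M` and `B` are `p`-primary, `B[p]` is finite
  have htorM : ∀ x : M, ∃ k : ℕ, p ^ k • x = 0 := fun x ↦ by
    obtain ⟨k, hk⟩ := x.2
    exact ⟨k, Subtype.ext (by rw [AddSubgroupClass.coe_nsmul, hk]; rfl)⟩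
  have hprimB : ∀ b : B, ∃ k : ℕ, p ^ k • b = 0 := fun b ↦ by
    obtain ⟨k, hk⟩ := htorM (b : M)
    exact ⟨k, Subtype.ext (by rw [AddSubgroupClass.coe_nsmul, hk]; rfl)⟩
  haveI : Finite (E.geomTorsion ((p : ℕ) : ℤ)) :=
    E.finite_torsionPoints_holds (AlgebraicClosure K) (by exact_mod_cast hpr.ne_zero)
  haveI : Finite ((B)[(p : ℕ)]) := by
    refine Finite.of_injective (fun x : (B)[(p : ℕ)] ↦
      (⟨(((x : B) : M) : E.geomPoints), ?_⟩ : E.geomTorsion ((p : ℕ) : ℤ))) ?_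
    · refine AddSubgroup.torsionBy.nsmul_iff.mpr ?_
      have h := congrArg (fun b : B ↦ ((b : M) : E.geomPoints))
        (AddSubgroup.torsionBy.nsmul_iff.mp x.2)
      simpa only [AddSubmonoidClass.coe_nsmul, ZeroMemClass.coe_zero] using h
    · intro x y hxy
      have h := congrArg Subtype.val hxy
      dsimp only at h
      exact Subtype.ext (Subtype.ext (Subtype.ext h))
  -- the stable image `D₀ = p^{j₀} B`: infinite and `p`-divisible
  obtain ⟨j₀, hj₀⟩ := PrimaryGroup.exists_powRange_succ_eq p hprimB
  obtain ⟨t, ht⟩ := PrimaryGroup.exists_card_quotient_powRange_le p hprimB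
  set D₀ : AddSubgroup B := (nsmulAddMonoidHom (p ^ j₀) : B →+ B).range with hD₀
  have hD₀inf : ¬ Finite D₀ := by
    intro hfin
    apply hinfB
    haveI := (ht j₀).1
    refine Nat.finite_of_card_ne_zero ?_
    rw [← AddSubgroup.card_mul_index D₀, AddSubgroup.index_eq_card]
    exact mul_ne_zero Nat.card_pos.ne' Nat.card_pos.ne'
  have hdiv₀ : ∀ x ∈ D₀, ∃ y ∈ D₀, p • y = x := by
    rintro x hx
    have hx' : x ∈ (nsmulAddMonoidHom (p ^ (j₀ + 1)) : B →+ B).range := by rw [hj₀]; exact hx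
    obtain ⟨c, rfl⟩ := hx'
    refine ⟨p ^ j₀ • c, ⟨c, rfl⟩, ?_⟩
    change p • p ^ j₀ • c = p ^ (j₀ + 1) • c
    rw [pow_succ', mul_smul]
  -- push the stable image down to `M = E[p^∞]`, then to `E(K̄)`
  set N : AddSubgroup M := D₀.map B.subtype with hN
  have hNdiv : ∀ c ∈ N, ∃ c' ∈ N, p • c' = c := by
    rintro _ ⟨b, hb, rfl⟩
    obtain ⟨c, hc, hcb⟩ := hdiv₀ b hb
    exact ⟨B.subtype c, ⟨c, hc, rfl⟩, by rw [← map_nsmul, hcb]⟩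
  have hNstab : ∀ (d : absoluteGaloisGroup K), ∀ c ∈ N, d • c ∈ N := by
    rintro d _ ⟨b, ⟨c, rfl⟩, rfl⟩
    set c' : B := ⟨d • (c : M), hBstab d c.2⟩ with hc'
    refine ⟨p ^ j₀ • c', ⟨c', rfl⟩, ?_⟩
    rw [map_nsmul, nsmulAddMonoidHom_apply, map_nsmul, smul_comm d (p ^ j₀) (B.subtype c)]
    rfl
  have hNfix : ∀ c ∈ N, ∀ g ∈ H, g • c = c := by
    rintro _ ⟨b, -, rfl⟩ g hg
    have hb : (b : M) ∈ FixedPoints.addSubgroup H M := b.2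
    rw [FixedPoints.mem_addSubgroup] at hb
    have h := hb ⟨g, hg⟩
    rw [Subgroup.mk_smul] at h
    exact h
  set N' : AddSubgroup E.geomPoints := N.map M.subtype with hN'
  have hprim' : ∀ P ∈ N', ∃ k : ℕ, p ^ k • P = 0 := by
    rintro _ ⟨x, -, rfl⟩
    exact x.2
  have hdiv' : ∀ P ∈ N', ∃ Q ∈ N', p • Q = P := by
    rintro _ ⟨x, hx, rfl⟩
    obtain ⟨y, hy, hyx⟩ := hNdiv x hx
    exact ⟨M.subtype y, ⟨y, hy, rfl⟩, by rw [← map_nsmul, hyx]⟩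
  have hstab' : ∀ (σ : absoluteGaloisGroup K) (P : E.geomPoints), P ∈ N' → σ • P ∈ N' := by
    rintro σ _ ⟨x, hx, rfl⟩
    exact ⟨σ • x, hNstab σ x hx, rfl⟩
  -- `N' ≠ ⊥` (else `D₀` would be trivial, hence finite)
  have hne' : N' ≠ ⊥ := by
    intro hbot
    apply hD₀inf
    haveI : Subsingleton D₀ := by
      refine ⟨fun x y ↦ Subtype.ext (B.subtype_injective (M.subtype_injective ?_))⟩
      have hx : M.subtype (B.subtype (x : B)) ∈ N' := ⟨B.subtype x, ⟨x, x.2, rfl⟩, rfl⟩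
      have hy : M.subtype (B.subtype (y : B)) ∈ N' := ⟨B.subtype y, ⟨y, y.2, rfl⟩, rfl⟩
      rw [hbot, AddSubgroup.mem_bot] at hx hy
      rw [hx, hy]
    infer_instance
  -- no rational CM: `E[p^∞] ≤ N'`, so `ker κ` fixes every `p`-power torsion point
  have hle : E.geomPrimaryTorsion p ≤ N' :=
    E.geomPrimaryTorsion_le_of_stable_divisible_of_not_hasRationalCM hCM hprim' hdiv' hstab' hne'
  have hfixall : ∀ g ∈ H, ∀ x : M, g • x = x := by
    intro g hg x
    obtain ⟨y, hy, hyx⟩ := hle x.2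
    have hxy : y = x := Subtype.ext hyx
    rw [← hxy]
    exact hNfix y hy g hg
  -- the norm-residue element `σ₀ ∈ ker κ` at a degree-one prime above `p`
  have h2 : Module.finrank ℚ K = 2 := hK.1
  obtain ⟨𝔭, h𝔭, he, hf⟩ := exists_degreeOnePrime_of_splitsIn K p h2 hsplit
  haveI := liesOver_span_of_natCast_mem (K := K) h𝔭
  have hdeg := ramificationIdx_mul_inertiaDeg_eq_one_of_splitsIn h2 hsplit h𝔭
  obtain ⟨h, π, hh, hπ⟩ := exists_pow_eq_span_singleton 𝔭
  obtain ⟨σ₀, -, hker, hcyc⟩ :=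
    ZpExtension.exists_isFrobPow_mem_kerSubgroup_of_isAnticyclotomic_anyPrime K p hK 𝔭 h𝔭 he hf h π hh hπ
  set g := absGaloisRestrict K (𝔭.adicCompletion K) σ₀ with hg
  have hgH : g ∈ H := hker κ hκ
  -- `ε(σ₀) = 1` …
  have hε : GaloisRep.cyclotomicCharacter K p g = 1 :=
    E.cyclotomicCharacter_eq_one_of_forall_smul_eq p g (hfixall g hgH)
  -- … against `ε(σ₀)·φ(π)² = p^{2h}` and the weight obstruction (`α = 1`, `a = p + 1`)
  have hB := mul_sq_eq_of_congruences (p := p) 𝔭 hdeg hπ hcyc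
  rw [hε, Units.val_one, one_mul] at hB
  set φ := integersToPadicInt 𝔭 p hdeg with hφ
  have hN : Ideal.absNorm 𝔭.asIdeal = p := by
    rw [Ideal.absNorm_apply, Submodule.cardQuot_apply, ← pow_one 𝔭.asIdeal, natCard_quot_pow' 𝔭 p hdeg 1,
      pow_one]
  have hφ' : Function.Injective ((PadicInt.Coe.ringHom (p := p)).comp φ) :=
    (Subtype.val_injective).comp (integersToPadicInt_injective 𝔭 p hdeg)
  refine ne_of_unitRoot_of_span_eq_pow (R := ℚ_[p]) h2 𝔭.isPrime hpr hN h𝔭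
    (natCast_notMem_sq 𝔭 p hdeg) hh hπ ((PadicInt.Coe.ringHom (p := p)).comp φ) hφ'
    (a := (p : ℤ) + 1) (α := (1 : ℚ_[p])) (by push_cast; ring) (s := 1) (Or.inl rfl) ?_
  have := congrArg (fun z : ℤ_[p] ↦ (z : ℚ_[p])) hB
  simpa using this

/-- **`stub_finGlob_two`'s currency, every prime:** for `W/ℚ`, an imaginary quadratic `K` with `p` split and `E_K = W.baseChange K`
WITHOUT `K`-rational CM, and an anticyclotomic `ℤ_p`-extension `κ`: `Finite (FixedPoints.addSubgroup κ.kerSubgroup (E_K.geomPrimaryTorsion p))`.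
On the split-bad CM class of crux 20368 the CM hypothesis holds for every `K ∌ √−7`, in particular every Heegner field of `N_W`.
[cite: GreenbergLNM1716, §1 p. 62] [cite: SilvermanAEC2009, Cor. IX.6.2] -/
theorem finGlob_of_not_hasRationalCM (W : WeierstrassCurve ℚ) [W.IsElliptic] (hK : IsImaginaryQuadratic K)
    (hsplit : SplitsIn K p) (hCM : ¬ (W.baseChange K).HasRationalCM) (κ : ZpExtension K p) (hκ : κ.IsAnticyclotomic) :
    Finite (FixedPoints.addSubgroup κ.kerSubgroup ((W.baseChange K).geomPrimaryTorsion p)) := by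
  haveI : (W.baseChange K).IsElliptic := by rw [baseChange]; infer_instance
  exact (W.baseChange K).finite_fixedPoints_kerSubgroup_of_not_hasRationalCM p hK hsplit hCM κ hκ

end WeierstrassCurve

end
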